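import Literature.NumberTheory.EllipticCurves.QuadraticTwistLocalPolynomialProofs
import Literature.NumberTheory.EllipticCurves.ArtinSchreierTwistProofs
import HarnessLib

/-!
# The local Euler factor of a quadratic twist by `d ≡ 1 (mod 4)` in residue characteristic `2`

Let `R` be a discrete valuation ring of residue characteristic `2` (`2 ∈ 𝔪_R`) with fraction
field `K` of characteristic `≠ 2` and finite residue field `k`, `X / K` an elliptic curve and
`d = 1 + 4c` with `c ∈ R` (so `d ∈ Rˣ` and `K(√d)/K` is unramified). The quadratic twist
`X^{(d)} = (0, d b₂/4, 0, d² b₄/2, d³ b₆/4)` (the tree's `WeierstrassCurve.quadraticTwist`) is not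
`R`-integral in general, but it is `K`-isomorphic to the integral equation

`X'_c : (a₁, c a₁² + d a₂, d a₃, 2dc a₁a₃ + d² a₄, d²c a₃² + d³ a₆)`

built from an integral model `(aᵢ)` of `X` (`smul_baseChange_twistLiftTwo`: the change of variables
`(1, 0, −a₁/2, −d a₃/2)`), whose reduction is the Artin–Schreier twist `Ē_{c̄}` of the reduction
`Ē` of `X` (`map_twistLiftTwo`; file `ArtinSchreierTwistProofs`). Consequently, exactly as in odd
residue characteristic (`QuadraticTwistLocalPolynomialProofs`):

* `isMinimal_twistLiftTwo`: `X'_c` is minimal when `X` is (twist back);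
* the reduction type is unchanged, split ↔ non-split are exchanged iff `c̄ ∉ ℘(k)`
  (`hasSplitMultiplicativeReduction_twistLiftTwo_iff`), and at a good place
  `q + 1 − #X̃'(k) = ± (q + 1 − #X̃(k))` with `+` iff `c̄ ∈ ℘(k)`;
* `localPolynomial_quadraticTwist_two`: **`L_v(X^{(d)}, T) = L_v(X, ±T)`** with sign `+` iff
  `c̄ = (d−1)/4 mod 𝔪` lies in `℘(k) = {z² + z}`; for `k = 𝔽₂` this is `+` iff `d ≡ 1 (mod 8)`,
  i.e. the sign is the Kronecker symbol `(d/2)`; and the rescaled forms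
  `localPowerSeries_quadraticTwist_two`, `localEulerFactor_quadraticTwist_two`.

This is the `2`-adic (unramified) case of "`a_𝔭(E ⊗ χ) = χ(𝔭) a_𝔭(E)`" (Silverman, *AEC* X.2,
X.5, Exercise 10.16 and App. A for characteristic `2`); it supplies the place `2` of the comparison
`L(E^{(p*)}, s) = L(E ⊗ χ_p, s)` (`p* ≡ 1 mod 4`) used for the Atkin–Lehner eigenvalue of the
newform of a quadratic twist. Everything is proved; no definitions (the model `X'_c` is written
out) and no named facts.

## References

* J. H. Silverman, *The Arithmetic of Elliptic Curves*, 2nd ed. 2009, VII.1 Prop. 1.3, VII.5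
  Prop. 5.1, X.2 Prop. 2.4, X.5 Cor. 5.4, App. A Prop. A.1.1, App. C §16.
* A. W. Knapp, *Elliptic Curves*, 1993, Prop. 12.10.
-/

noncomputable section

open scoped Classical

open IsLocalRing IsDiscreteValuationRing IsDedekindDomain.HeightOneSpectrum Polynomial

namespace WeierstrassCurve

variable (R : Type*) [CommRing R] [IsDomain R] [IsDiscreteValuationRing R]
  {K : Type*} [Field K] [Algebra R K] [IsFractionRing R K]

/-! ### The integral model `X'_c` of the twist by `1 + 4c` -/

section Model

/-- `1 + 4c` is a unit of `R` when `2 ∈ 𝔪_R`. [folklore] -/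
theorem isUnit_one_add_four_mul (hk : residue R 2 = 0) (c : R) : IsUnit (1 + 4 * c : R) := by
  rw [← IsLocalRing.residue_ne_zero_iff_isUnit, map_add, map_one, map_mul,
    show (4 : R) = 2 * 2 by norm_num, map_mul, hk, zero_mul, zero_mul, add_zero]
  exact one_ne_zero

omit [IsDomain R] [IsDiscreteValuationRing R] [IsFractionRing R K] in
/-- **The `2`-integral model of the twist by `d = 1 + 4c`**: for `X / K` integral with integral model
`I = (aᵢ)`, the change of variables `(1, 0, −a₁/2, −d a₃/2)` carries the base change of
`X'_c = (a₁, c a₁² + d a₂, d a₃, 2dc a₁a₃ + d² a₄, d²c a₃² + d³ a₆)` to `X^{(d)}` (complete the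
square: `b₂(X'_c) = d b₂`, `b₄(X'_c) = d² b₄`, `b₆(X'_c) = d³ b₆`; Silverman, *AEC* III.1 and App. A).
[folklore] -/
theorem smul_baseChange_twistLiftTwo [NeZero (2 : K)] (X : WeierstrassCurve K) [IsIntegral R X]
    (c : R) :
    (⟨1, 0, -X.a₁ / 2, -(algebraMap R K (1 + 4 * c)) * X.a₃ / 2⟩ : VariableChange K) •
        (⟨(X.integralModel R).a₁,
          c * (X.integralModel R).a₁ ^ 2 + (1 + 4 * c) * (X.integralModel R).a₂,
          (1 + 4 * c) * (X.integralModel R).a₃,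
          2 * (1 + 4 * c) * c * (X.integralModel R).a₁ * (X.integralModel R).a₃ +
            (1 + 4 * c) ^ 2 * (X.integralModel R).a₄,
          (1 + 4 * c) ^ 2 * c * (X.integralModel R).a₃ ^ 2 +
            (1 + 4 * c) ^ 3 * (X.integralModel R).a₆⟩ : WeierstrassCurve R).baseChange K =
      X.quadraticTwist (algebraMap R K (1 + 4 * c)) := by
  have h2 : (2 : K) ≠ 0 := two_ne_zero
  have h4 : (4 : K) ≠ 0 := by
    rw [show (4 : K) = 2 * 2 by norm_num]
    exact mul_ne_zero h2 h2
  have ha₁ := integralModel_a₁_eq R X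
  have ha₂ := integralModel_a₂_eq R X
  have ha₃ := integralModel_a₃_eq R X
  have ha₄ := integralModel_a₄_eq R X
  have ha₆ := integralModel_a₆_eq R X
  ext
  · simp only [variableChange_a₁, baseChange, map_a₁, Units.val_one, inv_one, one_mul, ha₁,
      quadraticTwist_a₁]
    field_simp
    ring
  · simp only [variableChange_a₂, baseChange, map_a₁, map_a₂, map_add, map_mul, map_pow, map_one,
      map_ofNat, Units.val_one, inv_one, one_pow, one_mul, mul_zero, add_zero, ha₁, ha₂,
      quadraticTwist_a₂, b₂]
    field_simp
    ring
  · simp only [variableChange_a₃, baseChange, map_a₁, map_a₃, map_add, map_mul, map_one, map_ofNat,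
      Units.val_one, inv_one, one_pow, one_mul, zero_mul, add_zero, ha₁, ha₃, quadraticTwist_a₃]
    field_simp
    ring
  · simp only [variableChange_a₄, baseChange, map_a₁, map_a₂, map_a₃, map_a₄, map_add, map_mul,
      map_pow, map_one, map_ofNat, Units.val_one, inv_one, one_pow, one_mul, zero_mul, mul_zero,
      add_zero, ha₁, ha₂, ha₃, ha₄, quadraticTwist_a₄, b₄]
    field_simp
    ring
  · simp only [variableChange_a₆, baseChange, map_a₁, map_a₂, map_a₃, map_a₄, map_a₆, map_add,
      map_mul, map_pow, map_one, map_ofNat, Units.val_one, inv_one, one_pow, one_mul, zero_mul,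
      add_zero, sub_zero, ha₁, ha₃, ha₆, quadraticTwist_a₆, b₆]
    field_simp
    ring

end Model

/-- Notation (local to this file) for the explicit `R`-model `X'_c` of the twist of `X` by `1 + 4c`. -/
local notation3 "𝕋[" R ", " X ", " c "]" =>
  (⟨(WeierstrassCurve.integralModel R X).a₁,
    c * (WeierstrassCurve.integralModel R X).a₁ ^ 2 + (1 + 4 * c) * (WeierstrassCurve.integralModel R X).a₂,
    (1 + 4 * c) * (WeierstrassCurve.integralModel R X).a₃,
    2 * (1 + 4 * c) * c * (WeierstrassCurve.integralModel R X).a₁ * (WeierstrassCurve.integralModel R X).a₃ +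
      (1 + 4 * c) ^ 2 * (WeierstrassCurve.integralModel R X).a₄,
    (1 + 4 * c) ^ 2 * c * (WeierstrassCurve.integralModel R X).a₃ ^ 2 +
      (1 + 4 * c) ^ 3 * (WeierstrassCurve.integralModel R X).a₆⟩ : WeierstrassCurve R)

/-! ### Integrality, invariants and minimality of `X'_c` -/

section ModelFacts

variable [NeZero (2 : K)]

omit [IsDomain R] [IsDiscreteValuationRing R] [IsFractionRing R K] [NeZero (2 : K)] in
/-- `X'_c ⊗ K` is integral (it is the base change of an `R`-equation). [folklore] -/
theorem isIntegral_baseChange_twistLiftTwo (X : WeierstrassCurve K) [IsIntegral R X] (c : R) :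
    IsIntegral R ((𝕋[R, X, c]).baseChange K) :=
  ⟨_, rfl⟩

omit [IsDomain R] [IsDiscreteValuationRing R] [IsFractionRing R K] in
/-- `Δ(X'_c) = d⁶ Δ(X)` (`d = 1 + 4c`): the twist model has the discriminant of `X^{(d)}`. [folklore] -/
theorem Δ_baseChange_twistLiftTwo (X : WeierstrassCurve K) [IsIntegral R X] (c : R) :
    ((𝕋[R, X, c]).baseChange K).Δ = algebraMap R K (1 + 4 * c) ^ 6 * X.Δ := by
  have h := congrArg WeierstrassCurve.Δ (smul_baseChange_twistLiftTwo R X c)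
  rw [variableChange_Δ, quadraticTwist_Δ, inv_one, Units.val_one, one_pow, one_mul] at h
  exact h

omit [IsDomain R] [IsDiscreteValuationRing R] [IsFractionRing R K] in
/-- `c₄(X'_c) = d² c₄(X)` (`d = 1 + 4c`). [folklore] -/
theorem c₄_baseChange_twistLiftTwo (X : WeierstrassCurve K) [IsIntegral R X] (c : R) :
    ((𝕋[R, X, c]).baseChange K).c₄ = algebraMap R K (1 + 4 * c) ^ 2 * X.c₄ := by
  have h := congrArg WeierstrassCurve.c₄ (smul_baseChange_twistLiftTwo R X c)
  rw [variableChange_c₄, quadraticTwist_c₄, inv_one, Units.val_one, one_pow, one_mul] at h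
  exact h

/-- `v(Δ(X'_c)) = v(Δ(X))` (`d = 1 + 4c` is a unit when `2 ∈ 𝔪_R`). [folklore] -/
theorem valuation_Δ_baseChange_twistLiftTwo (hk : residue R 2 = 0) (X : WeierstrassCurve K)
    [IsIntegral R X] (c : R) :
    valuation K (maximalIdeal R) ((𝕋[R, X, c]).baseChange K).Δ = valuation K (maximalIdeal R) X.Δ := by
  obtain ⟨u, hu⟩ := isUnit_one_add_four_mul R hk c
  rw [Δ_baseChange_twistLiftTwo, map_mul, map_pow, ← hu, valuation_algebraMap_units, one_pow, one_mul]

/-- `v(c₄(X'_c)) = v(c₄(X))`. [folklore] -/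
theorem valuation_c₄_baseChange_twistLiftTwo (hk : residue R 2 = 0) (X : WeierstrassCurve K)
    [IsIntegral R X] (c : R) :
    valuation K (maximalIdeal R) ((𝕋[R, X, c]).baseChange K).c₄ =
      valuation K (maximalIdeal R) X.c₄ := by
  obtain ⟨u, hu⟩ := isUnit_one_add_four_mul R hk c
  rw [c₄_baseChange_twistLiftTwo, map_mul, map_pow, ← hu, valuation_algebraMap_units, one_pow, one_mul]

omit [IsDomain R] [IsDiscreteValuationRing R] [IsFractionRing R K] in
/-- `X'_c ⊗ K` is an equation of the curve `X^{(d)}`: `X'_c ⊗ K = C⁻¹ • X^{(d)}`. [folklore] -/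
theorem exists_baseChange_twistLiftTwo_eq_smul (X : WeierstrassCurve K) [IsIntegral R X] (c : R) :
    ∃ D : VariableChange K, (𝕋[R, X, c]).baseChange K = D • X.quadraticTwist (algebraMap R K (1 + 4 * c)) :=
  ⟨_, (eq_inv_smul_iff.mpr (smul_baseChange_twistLiftTwo R X c))⟩

omit [IsDomain R] [IsDiscreteValuationRing R] [IsFractionRing R K] in
/-- Twisting twice by a non-zero `d` gives back a `K`-isomorphic equation:
`(X^{(d)})^{(d)} = X^{(d²)} = D • X`. [folklore] -/
theorem exists_quadraticTwist_quadraticTwist_eq_smul (X : WeierstrassCurve K) {d : K} (hd : d ≠ 0) :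
    ∃ D : VariableChange K, (X.quadraticTwist d).quadraticTwist d = D • X := by
  obtain ⟨C, hC⟩ := X.exists_variableChange_smul_eq_quadraticTwist_sq hd
  exact ⟨C, by rw [quadraticTwist_quadraticTwist, ← sq, hC]⟩

/-- **The twist model of a minimal equation is minimal** (`2 ∈ 𝔪_R`, `d = 1 + 4c`): if
`C • (X'_c ⊗ K)` is integral, the twist model of *that* equation is an integral equation of
`(X^{(d)})^{(d)} ≅ X`, so by minimality of `X`,
`v(Δ(C • X'_c)) = v(Δ) of its twist model ≥ v(Δ(X)) = v(Δ(X'_c))`. [folklore] -/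
theorem isMinimal_baseChange_twistLiftTwo (hk : residue R 2 = 0) (X : WeierstrassCurve K) [IsMinimal R X]
    (c : R) : IsMinimal R ((𝕋[R, X, c]).baseChange K) := by
  have hd0 : algebraMap R K (1 + 4 * c) ≠ 0 :=
    (map_ne_zero_iff _ (IsFractionRing.injective R K)).mpr (isUnit_one_add_four_mul R hk c).ne_zero
  haveI hTint : IsIntegral R ((𝕋[R, X, c]).baseChange K) := isIntegral_baseChange_twistLiftTwo R X c
  rw [isMinimal_iff]
  refine ⟨by simpa using hTint, fun C hC _ ↦ ?_⟩
  change IsIntegral R (C • (𝕋[R, X, c]).baseChange K) at hC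
  haveI := hC
  simp only [one_smul]
  rw [← Subtype.coe_le_coe, valuation_Δ_aux_eq_of_isIntegral, valuation_Δ_aux_eq_of_isIntegral]
  -- the twist model of the integral equation `Z = C • X'_c` is an integral equation of `X`
  set Z := C • (𝕋[R, X, c]).baseChange K with hZ
  obtain ⟨D₁, hD₁⟩ := exists_baseChange_twistLiftTwo_eq_smul R Z c
  obtain ⟨D₂, hD₂⟩ := exists_baseChange_twistLiftTwo_eq_smul R X c
  obtain ⟨D₄, hD₄⟩ := exists_quadraticTwist_quadraticTwist_eq_smul X hd0
  have heq : (𝕋[R, Z, c]).baseChange K =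
      (D₁ * ⟨(C * D₂).u, algebraMap R K (1 + 4 * c) * (C * D₂).r, 0, 0⟩ * D₄) • X := by
    rw [hD₁, hZ, hD₂, smul_smul, quadraticTwist_smul, hD₄, mul_smul, mul_smul]
  haveI hint : IsIntegral R ((𝕋[R, Z, c]).baseChange K) := isIntegral_baseChange_twistLiftTwo R Z c
  have hle := valuation_Δ_smul_le_of_isMinimal R X _ (heq ▸ hint)
  rw [← heq, valuation_Δ_baseChange_twistLiftTwo R hk Z c] at hle
  rwa [valuation_Δ_baseChange_twistLiftTwo R hk X c]

end ModelFacts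

/-! ### Reduction: `X'_c mod 𝔪` is the Artin–Schreier twist of `X mod 𝔪` by `c̄` -/

section Reduction

omit [IsFractionRing R K] in
/-- **The reduction of `X'_c` is the Artin–Schreier twist `Ē_{c̄}`** of the reduction `Ē` of the
integral model of `X` (`d̄ = 1`, `2̄ = 0`). [folklore] -/
theorem map_twistLiftTwo (hk : residue R 2 = 0) (X : WeierstrassCurve K) [IsIntegral R X] (c : R) :
    (𝕋[R, X, c]).map (residue R) =
      ⟨((X.integralModel R).map (residue R)).a₁,
        ((X.integralModel R).map (residue R)).a₂ +
          residue R c * ((X.integralModel R).map (residue R)).a₁ ^ 2,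
        ((X.integralModel R).map (residue R)).a₃,
        ((X.integralModel R).map (residue R)).a₄,
        ((X.integralModel R).map (residue R)).a₆ +
          residue R c * ((X.integralModel R).map (residue R)).a₃ ^ 2⟩ := by
  have hd : residue R (1 + 4 * c) = 1 := by
    rw [map_add, map_one, map_mul, show (4 : R) = 2 * 2 by norm_num, map_mul, hk, zero_mul, zero_mul,
      add_zero]
  ext
  · simp
  · simp only [map_a₂, map_a₁, map_add, map_mul, map_pow, hd, one_mul]
    ring
  · simp only [map_a₃, map_mul, hd, one_mul]
  · simp only [map_a₄, map_add, map_mul, map_pow, hd, hk, one_pow, one_mul,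
      zero_mul, zero_add]
  · simp only [map_a₆, map_a₃, map_add, map_mul, map_pow, hd, one_pow, one_mul]
    ring

omit [IsDomain R] [IsDiscreteValuationRing R] [IsFractionRing R K] in
/-- Reducing Mathlib's node-tangent polynomial of an `R`-equation gives the node-tangent polynomial
of the reduced equation. [folklore] -/
theorem map_nodalTangents {S : Type*} [CommRing S] (f : R →+* S) (W : WeierstrassCurve R) :
    (Polynomial.C W.c₄ * Polynomial.X ^ 2 + Polynomial.C (W.a₁ * W.c₄) * Polynomial.X -
        Polynomial.C (54 * W.b₆ - 3 * W.b₂ * W.b₄ + W.a₂ * W.c₄)).map f =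
      Polynomial.C (W.map f).c₄ * Polynomial.X ^ 2 + Polynomial.C ((W.map f).a₁ * (W.map f).c₄) *
        Polynomial.X - Polynomial.C (54 * (W.map f).b₆ - 3 * (W.map f).b₂ * (W.map f).b₄ +
          (W.map f).a₂ * (W.map f).c₄) := by
  simp only [Polynomial.map_sub, Polynomial.map_add, Polynomial.map_mul, Polynomial.map_pow,
    Polynomial.map_C, Polynomial.map_X, map_c₄, map_b₂, map_b₄, map_b₆, map_a₁, map_a₂, map_mul f,
    map_sub f, map_add f, map_ofNat f]

end Reduction

/-! ### Reduction types of `X'_c` -/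

section ReductionType

variable [NeZero (2 : K)] {X : WeierstrassCurve K} [IsMinimal R X] {c : R}
  [IsMinimal R ((𝕋[R, X, c]).baseChange K)]

/-- Good reduction is unchanged (`v(Δ)` is). [cite: SilvermanAEC2009, VII.5 Prop. 5.1(a)] -/
theorem hasGoodReduction_twistLiftTwo_iff (hk : residue R 2 = 0) :
    ((𝕋[R, X, c]).baseChange K).HasGoodReduction R ↔ X.HasGoodReduction R := by
  rw [hasGoodReduction_iff, hasGoodReduction_iff, valuation_Δ_baseChange_twistLiftTwo R hk]
  exact and_congr_left' ⟨fun _ ↦ inferInstance, fun _ ↦ inferInstance⟩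

/-- Multiplicative reduction is unchanged (`v(Δ)`, `v(c₄)` are). [cite: SilvermanAEC2009, VII.5 Prop. 5.1(b)] -/
theorem hasMultiplicativeReduction_twistLiftTwo_iff (hk : residue R 2 = 0) :
    ((𝕋[R, X, c]).baseChange K).HasMultiplicativeReduction R ↔ X.HasMultiplicativeReduction R := by
  rw [hasMultiplicativeReduction_iff, hasMultiplicativeReduction_iff,
    valuation_Δ_baseChange_twistLiftTwo R hk, valuation_c₄_baseChange_twistLiftTwo R hk]
  exact and_congr_left' ⟨fun _ ↦ inferInstance, fun _ ↦ inferInstance⟩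

/-- Additive reduction is unchanged (`v(Δ)`, `v(c₄)` are). [cite: SilvermanAEC2009, VII.5 Prop. 5.1(c)] -/
theorem hasAdditiveReduction_twistLiftTwo_iff (hk : residue R 2 = 0) :
    ((𝕋[R, X, c]).baseChange K).HasAdditiveReduction R ↔ X.HasAdditiveReduction R := by
  rw [hasAdditiveReduction_iff, hasAdditiveReduction_iff,
    valuation_Δ_baseChange_twistLiftTwo R hk, valuation_c₄_baseChange_twistLiftTwo R hk]
  exact and_congr_left' ⟨fun _ ↦ inferInstance, fun _ ↦ inferInstance⟩

/-- **Split multiplicative reduction of the `2`-adic twist**: if `X` (minimal) has multiplicative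
reduction then `X'_c` is split iff (`c̄ ∈ ℘(k)` ↔ `X` is split) — the node-tangent polynomials
reduce to those of `Ē` and its Artin–Schreier twist `Ē_{c̄}` (`splits_nodalTangents_asTwist_iff`).
[folklore] -/
theorem hasSplitMultiplicativeReduction_twistLiftTwo_iff [Finite (ResidueField R)] (hk : residue R 2 = 0)
    (hmult : X.HasMultiplicativeReduction R) :
    ((𝕋[R, X, c]).baseChange K).HasSplitMultiplicativeReduction R ↔
      ((∃ z : ResidueField R, z ^ 2 + z = residue R c) ↔ X.HasSplitMultiplicativeReduction R) := by
  have h2k : (2 : ResidueField R) = 0 := by rw [← map_ofNat (residue R) 2, hk]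
  haveI : IsIntegral R ((𝕋[R, X, c]).baseChange K) := inferInstance
  -- the integral model of `X'_c ⊗ K` is `X'_c` (`integralModel_eq_of_baseChange_eq`)
  have hint : integralModel R ((𝕋[R, X, c]).baseChange K) = 𝕋[R, X, c] :=
    integralModel_eq_of_baseChange_eq _ _ rfl
  have hYmult : ((𝕋[R, X, c]).baseChange K).HasMultiplicativeReduction R :=
    (hasMultiplicativeReduction_twistLiftTwo_iff R hk).mpr hmult
  set I := X.integralModel R with hI
  have hc₄ : (I.map (residue R)).c₄ ≠ 0 := by
    intro h
    have h1 := hmult.multiplicativeReduction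
    rw [← integralModel_c₄_eq R X, valuation_eq_one_iff_notMem] at h1
    rw [map_c₄] at h
    exact h1 ((residue_eq_zero_iff _).mp h)
  have key := splits_nodalTangents_asTwist_iff h2k (I.map (residue R)) hc₄ (residue R c)
    ((𝕋[R, X, c]).map (residue R)) (map_twistLiftTwo R hk X c)
  have hpoly : (Polynomial.map (algebraMap R (ResidueField R)) (Polynomial.C I.c₄ * Polynomial.X ^ 2 +
      Polynomial.C (I.a₁ * I.c₄) * Polynomial.X -
        Polynomial.C (54 * I.b₆ - 3 * I.b₂ * I.b₄ + I.a₂ * I.c₄))).Splits ↔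
      (Polynomial.C (I.map (residue R)).c₄ * Polynomial.X ^ 2 +
        Polynomial.C ((I.map (residue R)).a₁ * (I.map (residue R)).c₄) * Polynomial.X -
        Polynomial.C (54 * (I.map (residue R)).b₆ - 3 * (I.map (residue R)).b₂ * (I.map (residue R)).b₄ +
          (I.map (residue R)).a₂ * (I.map (residue R)).c₄)).Splits := by
    rw [IsLocalRing.ResidueField.algebraMap_eq, map_nodalTangents]
  have hXsplit : X.HasSplitMultiplicativeReduction R ↔
      (Polynomial.C (I.map (residue R)).c₄ * Polynomial.X ^ 2 +
        Polynomial.C ((I.map (residue R)).a₁ * (I.map (residue R)).c₄) * Polynomial.X -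
        Polynomial.C (54 * (I.map (residue R)).b₆ - 3 * (I.map (residue R)).b₂ * (I.map (residue R)).b₄ +
          (I.map (residue R)).a₂ * (I.map (residue R)).c₄)).Splits := by
    rw [hasSplitMultiplicativeReduction_iff]
    exact ⟨fun ⟨_, hs⟩ ↦ hpoly.mp hs, fun hs ↦ ⟨hmult, hpoly.mpr hs⟩⟩
  rw [hasSplitMultiplicativeReduction_iff, hXsplit]
  constructor
  · rintro ⟨h1, hs⟩
    rw [hint, IsLocalRing.ResidueField.algebraMap_eq, map_nodalTangents] at hs
    exact key.mp hs
  · intro h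
    refine ⟨hYmult, ?_⟩
    rw [hint, IsLocalRing.ResidueField.algebraMap_eq, map_nodalTangents]
    exact key.mpr h

omit [NeZero (2 : K)] in
/-- **Point count at a good place**: `q + 1 − #X̃'_c(k) = ± (q + 1 − #X̃(k))`, `+` iff `c̄ ∈ ℘(k)`
(the reductions are `Ē_{c̄}` and `Ē`; `card_add_one_sub_natCard_point_asTwist`). [folklore] -/
theorem card_sub_natCard_point_reduction_twistLiftTwo [Finite (ResidueField R)] (hk : residue R 2 = 0)
    (hgood : X.HasGoodReduction R) :
    (Nat.card (ResidueField R) : ℤ) + 1 - Nat.card (((𝕋[R, X, c]).baseChange K).reduction R).toAffine.Point =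
      (if ∃ z : ResidueField R, z ^ 2 + z = residue R c then 1 else -1) *
        ((Nat.card (ResidueField R) : ℤ) + 1 - Nat.card (X.reduction R).toAffine.Point) := by
  haveI := Fintype.ofFinite (ResidueField R)
  have h2k : (2 : ResidueField R) = 0 := by rw [← map_ofNat (residue R) 2, hk]
  haveI : (X.reduction R).IsElliptic := (hasGoodReduction_iff_isElliptic_reduction R).mp hgood
  haveI : IsIntegral R ((𝕋[R, X, c]).baseChange K) := inferInstance
  have hred : ((𝕋[R, X, c]).baseChange K).reduction R = (𝕋[R, X, c]).map (residue R) := by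
    rw [reduction, integralModel_eq_of_baseChange_eq _ (𝕋[R, X, c]) rfl]
  rw [hred, map_twistLiftTwo R hk X c, Nat.card_eq_fintype_card]
  convert card_add_one_sub_natCard_point_asTwist h2k (X.reduction R) (residue R c) using 3
  rfl

end ReductionType

/-! ### The local polynomial and the local Euler factor of the `2`-adic twist -/

section LocalPolynomial

variable [NeZero (2 : K)] [Finite (ResidueField R)]

/-- **The local polynomial of a quadratic twist by `d = 1 + 4c` in residue characteristic `2`**:
if `L_v(X, T) = 1 − A T + B T²` is Mathlib's local polynomial of the elliptic curve `X / K` then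
`L_v(X^{(d)}, T) = 1 − sA T + B T²` with `s = 1` if `c̄ ∈ ℘(k) = {z² + z}` and `s = −1` otherwise
(for `k = 𝔽₂`: `s = 1` iff `d ≡ 1 (mod 8)`, the Kronecker symbol `(d/2)`) — the unramified quadratic
twist at `2` (Silverman, *AEC* X.2, Exercise 10.16, App. A). [folklore] -/
theorem localPolynomial_quadraticTwist_two (hk : residue R 2 = 0) (X : WeierstrassCurve K) [X.IsElliptic]
    (c : R) :
    ∃ A B : ℤ, X.localPolynomial R = 1 - Polynomial.C A * Polynomial.X + Polynomial.C B * Polynomial.X ^ 2 ∧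
      (X.quadraticTwist (algebraMap R K (1 + 4 * c))).localPolynomial R =
        1 - Polynomial.C ((if ∃ z : ResidueField R, z ^ 2 + z = residue R c then 1 else -1) * A) *
          Polynomial.X + Polynomial.C B * Polynomial.X ^ 2 := by
  have hd0 : algebraMap R K (1 + 4 * c) ≠ 0 :=
    (map_ne_zero_iff _ (IsFractionRing.injective R K)).mpr (isUnit_one_add_four_mul R hk c).ne_zero
  -- reduce to the chosen minimal model `Xm` of `X`
  set Xm := X.minimal R with hXm
  haveI : Xm.IsElliptic := isElliptic_minimal R X
  have hX : X = ((X.exists_isMinimal R).choose)⁻¹ • Xm := (inv_smul_smul _ X).symm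
  haveI : (Xm.quadraticTwist (algebraMap R K (1 + 4 * c))).IsElliptic := Xm.isElliptic_quadraticTwist hd0
  haveI hTe : ((𝕋[R, Xm, c]).baseChange K).IsElliptic := by
    rw [isElliptic_iff, Δ_baseChange_twistLiftTwo]
    exact (IsUnit.pow 6 (isUnit_iff_ne_zero.mpr hd0)).mul Xm.isUnit_Δ
  have hlpX : X.localPolynomial R = Xm.localPolynomial R := by
    conv_lhs => rw [hX]
    exact localPolynomial_smul R Xm _
  have hlpY : (X.quadraticTwist (algebraMap R K (1 + 4 * c))).localPolynomial R =
      ((𝕋[R, Xm, c]).baseChange K).localPolynomial R := by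
    conv_lhs => rw [hX]
    rw [quadraticTwist_smul, localPolynomial_smul, ← smul_baseChange_twistLiftTwo R Xm c,
      localPolynomial_smul]
  haveI : IsMinimal R ((𝕋[R, Xm, c]).baseChange K) := isMinimal_baseChange_twistLiftTwo R hk Xm c
  rw [hlpX, hlpY, localPolynomial_eq_of_isMinimal R Xm,
    localPolynomial_eq_of_isMinimal R ((𝕋[R, Xm, c]).baseChange K)]
  simp only [hasGoodReduction_twistLiftTwo_iff R hk, hasMultiplicativeReduction_twistLiftTwo_iff R hk]
  by_cases hg : Xm.HasGoodReduction R
  · refine ⟨(Nat.card (ResidueField R) : ℤ) + 1 - Nat.card (Xm.reduction R).toAffine.Point,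
      Nat.card (ResidueField R), by rw [if_pos hg], ?_⟩
    rw [if_pos hg, card_sub_natCard_point_reduction_twistLiftTwo R hk hg]
  by_cases hm : Xm.HasMultiplicativeReduction R
  · rw [if_neg hg, if_neg hg, hasSplitMultiplicativeReduction_twistLiftTwo_iff R hk hm, if_pos hm]
    by_cases hs : Xm.HasSplitMultiplicativeReduction R
    · refine ⟨1, 0, by rw [if_pos hs]; simp, ?_⟩
      by_cases hsq : ∃ z : ResidueField R, z ^ 2 + z = residue R c
      · rw [if_pos (iff_of_true hsq hs), if_pos hsq]
        simp
      · rw [if_neg (fun h ↦ hsq (h.mpr hs)), if_neg hsq]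
        simp
    · refine ⟨-1, 0, by rw [if_neg hs]; simp, ?_⟩
      by_cases hsq : ∃ z : ResidueField R, z ^ 2 + z = residue R c
      · rw [if_neg (fun h ↦ hs (h.mp hsq)), if_pos hsq]
        simp
      · rw [if_pos (iff_of_false hsq hs), if_neg hsq]
        simp
  · have hs : ¬ Xm.HasSplitMultiplicativeReduction R := fun h ↦ hm h.toHasMultiplicativeReduction
    have hs' : ¬ ((𝕋[R, Xm, c]).baseChange K).HasSplitMultiplicativeReduction R := fun h ↦
      hm ((hasMultiplicativeReduction_twistLiftTwo_iff R hk).mp h.toHasMultiplicativeReduction)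
    refine ⟨0, 0, by rw [if_neg hg, if_neg hs, if_neg hm]; simp, ?_⟩
    rw [if_neg hg, if_neg hs', if_neg hm]
    simp

/-- **The inverted local factor of the `2`-adic quadratic twist is the rescaling by `s = ±1`**
(`s = 1` iff `c̄ ∈ ℘(k)`). [folklore] -/
theorem localPowerSeries_quadraticTwist_two (hk : residue R 2 = 0) (X : WeierstrassCurve K) [X.IsElliptic]
    (c : R) :
    (X.quadraticTwist (algebraMap R K (1 + 4 * c))).localPowerSeries R =
      PowerSeries.rescale (if ∃ z : ResidueField R, z ^ 2 + z = residue R c then 1 else -1 : ℤ)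
        (X.localPowerSeries R) := by
  obtain ⟨A, B, hX, hY⟩ := localPolynomial_quadraticTwist_two R hk X c
  have hs : (if ∃ z : ResidueField R, z ^ 2 + z = residue R c then 1 else -1 : ℤ) *
      (if ∃ z : ResidueField R, z ^ 2 + z = residue R c then 1 else -1 : ℤ) = 1 := by
    split_ifs <;> norm_num
  have hφ : PowerSeries.constantCoeff ((1 - Polynomial.C A * Polynomial.X +
      Polynomial.C B * Polynomial.X ^ 2 : ℤ[X]) : PowerSeries ℤ) = 1 := by
    rw [← PowerSeries.coeff_zero_eq_constantCoeff_apply, Polynomial.coeff_coe]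
    simp
  rw [localPowerSeries, localPowerSeries, hY, hX, coe_quadratic_eq_rescale A B _ hs,
    invOfUnit_rescale _ hφ]

/-- **The local Euler factor of the `2`-adic quadratic twist**: obtained from that of `X` by
rescaling the inverted local factor by `s = ±1` (`s = 1` iff `c̄ ∈ ℘(k)`), i.e. its coefficient at
`q_v^i` is `s^i` times that of `X`. [folklore] -/
theorem localEulerFactor_quadraticTwist_two (hk : residue R 2 = 0) (X : WeierstrassCurve K) [X.IsElliptic]
    (c : R) :
    (X.quadraticTwist (algebraMap R K (1 + 4 * c))).localEulerFactor R =
      ArithmeticFunction.ofPowerSeries (Nat.card (ResidueField R))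
        (PowerSeries.rescale (if ∃ z : ResidueField R, z ^ 2 + z = residue R c then 1 else -1 : ℤ)
          (X.localPowerSeries R)) := by
  rw [localEulerFactor, localPowerSeries_quadraticTwist_two R hk X c]

end LocalPolynomial

end WeierstrassCurve

end
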